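import Literature.AnabelianGeometry.EtaleTheta.Discharge.Sec3WeakColumnOfProp34Const
import HarnessLib

/-!
# [EtTh] Theorem 3.7 (i)–(iv) — END KNIT at the weak `Λ = ℚ` / `Λ = ℝ` data with the PRINTED constant-field category
# `D^cnst = 𝓑(G_K)⁰`, and the knits onto `DivisorMonoids.Prop34Const` (proof-only)

S. Mochizuki, *The étale theta function and its Frobenioid-theoretic manifestations*, Publ. RIMS **45**
(2009) [EtTh], Thm. 3.7, PDF pp. 79–80; the setting p. 72 (printed 298) "`D^cnst := B(Spec K)⁰`"; Prop. 3.4 (ii)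
p. 74 [cite: MochizukiEtTh2009, Thm 3.7 p.79].

WEAK-VOCABULARY TWIN of the `Λ = ℚ` / `Λ = ℝ` parts of abc-iut-w5-d164's `Discharge/Sec3Thm37OfInputsOfProp34Const.lean`
(p437493: `thm37_ofRlfQ_of_inputs_of_cosetCnst` / `…_of_prop34Const`, `thm37_ofRlfR_of_inputs_of_cosetCnst` /
`…_of_prop34Const`), at abc-iut-L6-t12's weak constructors `ofRlfQWeak` / `ofRlfRWeak` (`hpf : ∀ Y, IsPerfFactorialCof
(Φ₀ Y)` — the `Ÿ` / `Z_∞`-type coverings where the strong constructors are VACUOUS, cell finding F-L2d2-1).  Sequel of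
`Sec3Thm37OfInputsWeak.lean` (the `Λ = ℤ` coset / `Prop34Const` forms are there and in
`Sec3WeakColumnOfProp34Const.lean`).  The vocabulary-generic `thm37_of_inputs_of_cnst` (abc-iut-w5-d164 / w5-d250),
`CosetCat.isOfFinOrder_aut`, the weak constant line `ofRlf{Q,R}Weak_line`, `IsPerfFactorialWeak.Rlf.isCancelMul`,
`Prop34Cnst.ofRlfQWeak` / `ofRlfRWeak_of_eff`, `ofRlfRWeak_divΛ_injective` are consumed BY NAME:

* `thm37_ofRlfQWeak_of_inputs_of_cosetCnst` — residual {`hBmon`, `hD`, `hnd`, `hrat`, `h34`, `h₀`, `hQ`, `hcyc`};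
  `…_of_prop34Const` — {`hBmon`, `hD`, `hnd`, `hrat`, `h34`, `h₀`, `hQ`, `hC`};
* `thm37_ofRlfRWeak_of_inputs_of_cosetCnst` — residual {`hBmon`, `hD`, `hnd`, `hrat`, `h₀`, `hE`, `hcyc`};
  `…_of_prop34Const` — {`hBmon`, `hD`, `hnd`, `hrat`, `h₀`, `hE`, `hC`}
— IDENTICAL residual lists to the strong forms.  (The tempered Frobenioid `C₀` over the WEAK data is bound IN each
statement, so that no statement is textually its strong twin.)  The strong `…ofRlfR_fin…` forms ("finitely many
primes") are NOT twinned: false by design at the weak data.  Seat abc-iut-L6-t12 (gen 4), cell abc-iut, row «§3 WEAK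
COLUMN at Λ = ℚ/ℝ» piece (W8).  PROOF-ONLY (0 defs).  HONEST FRAMING: bookkeeping over PROVED rows; refereed pre-IUT
material; no statement of [EtTh]/[FrdI] is strengthened; nothing here bears on [IUTchIII] Cor. 3.12; typed ≠ proved —
here PROVED modulo the literal binders.
-/

namespace Literature.AnabelianGeometry.EtaleTheta

open CategoryTheory Opposite Literature.AlgebraicGeometry.Frobenioids Literature.AnabelianGeometry.SemiGraphs

namespace TemperedFrobenioid

universe u₀ v₀ u₁ u v w uK

variable {D₀ : Type u₀} [Category.{v₀} D₀] {dm : DivisorMonoids.{u₀, v₀, w} D₀}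
  {hpf : ∀ Y : D₀ᵒᵖ, IsPerfFactorialCof (dm.Φ₀.obj Y)} {V : FrdIMonoidStub.{w}} {V₀ : FrdICatStub.{u₀, v₀, w} D₀}
  {D : Type u} [Category.{v} D] {IsRational IsStrictlyRational : (Dᵒᵖ ⥤ CommMonCat.{w}) → Prop}
  {GK : Type u₁} [Group GK] [TopologicalSpace GK] [SeparatelyContinuousMul GK] [CompactSpace GK]
  {cnst : D₀ ⥤ CosetCat GK}

/-! ### §1 `Λ = ℚ` weak data, `D^cnst = 𝓑(G)⁰` -/

/-- **[EtTh] Theorem 3.7 (i)–(iii) for a tempered Frobenioid of monoid type `ℚ` over the CONSTRUCTED weak data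
`ofRlfQWeak dm hpf`, with `D^cnst = 𝓑(G)⁰` (`G` compact, e.g. `G_K`)** — the Aut-invariance input `hKfix` of
`thm37_ofRlfQWeak_of_inputs` DERIVED (`hLine` ⟸ `hcyc` by `ofRlfQWeak_line`, `hInt` ⟸
`IsPerfFactorialWeak.Rlf.isCancelMul`, `hfin` ⟸ `CosetCat.isOfFinOrder_aut`): residual binders {`hBmon`, `hD`, `hnd`,
`hrat`, `h34`, `h₀`, `hQ`, `hcyc`}.  (i) without the unit conjuncts (print restricts them to `ℤ`/`ℝ`); (ii); (iii) both
clauses. [cite: MochizukiEtTh2009, Thm 3.7 p.79] -/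
theorem thm37_ofRlfQWeak_of_inputs_of_cosetCnst
    (C₀ : TemperedFrobenioid (RealifiedDivisorMonoids.ofRlfQWeak dm hpf) D
      (treeCatVocab D IsRational IsStrictlyRational))
    (hBmon : IsMonoidOn C₀.ratFnFunctor)
    (hD : IsOfFSMFFType D) (hnd : IsNonDilatingOn C₀.divisorMonoid)
    (hrat : ∀ X : C₀.category,
      PreFrobenioidData.IsRational
        (PreFrobenioid.biratData (C₀.isFrobenioid_treeCatVocab_of_isMonoidOn hBmon)
          (PreFrobenioid.hasBiratSquares_of_isFrobenioid (C₀.isFrobenioid_treeCatVocab_of_isMonoidOn hBmon)))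
        (S := PreFrobenioidData.ofFunctor C₀.divisorMonoid C₀.toElem) (fun a 𝔭 => PrimarySupp a 𝔭) X)
    (h34 : dm.Prop34 V V₀) (h₀ : dm.Prop34Cnst₀ cnst)
    (hQ : ∀ {Y : D₀} (g g' : Y ≅ Y),
      (∀ b : dm.B₀.obj (op Y), dm.div₀ (op Y) b = 1 →
        ∃ N : ℕ+, ((dm.B₀.map g.hom.op).hom b) ^ (N : ℕ) = ((dm.B₀.map g'.hom.op).hom b) ^ (N : ℕ)) →
      cnst.map g.hom = cnst.map g'.hom)
    (hcyc : ∀ Y : D₀ᵒᵖ, ∃ d : dm.Φ₀.obj Y, ∀ b ∈ dm.F₀ Y, ∃ n : ℤ,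
      dm.div₀ Y b = Algebra.GrothendieckGroup.of d ^ n)
    :
    (PreFrobenioid.IsOfIsotropicType C₀.toElem ∧
      PreFrobenioid.IsOfModelType C₀.toElem (C₀.isFrobenioid_treeCatVocab_of_isMonoidOn hBmon)
        (PreFrobenioid.hasBiratSquares_of_isFrobenioid (C₀.isFrobenioid_treeCatVocab_of_isMonoidOn hBmon)) ∧
      PreFrobenioidData.IsOfBiratFrobeniusNormalizedType
        (PreFrobenioid.biratData (C₀.isFrobenioid_treeCatVocab_of_isMonoidOn hBmon)
          (PreFrobenioid.hasBiratSquares_of_isFrobenioid (C₀.isFrobenioid_treeCatVocab_of_isMonoidOn hBmon))) ∧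
      PreFrobenioid.IsOfType (PreFrobenioid.IsSubQuasiFrobeniusTrivial C₀.toElem) ∧
      ¬ PreFrobenioid.IsOfType (PreFrobenioid.IsGroupLikeObj C₀.toElem)) ∧
    ((ModelFrobenioid.data C₀.divisorMonoid C₀.ratFnFunctor C₀.divBNatTrans).IsOfStandardType ∧
      (PreFrobenioidData.ofFunctor C₀.divisorMonoid C₀.toElem).IsOfRationallyStandardType
        (PreFrobenioid.rsParams (C₀.isFrobenioid_treeCatVocab_of_isMonoidOn hBmon) fun a 𝔭 => PrimarySupp a 𝔭)) ∧
    ((∀ A : C₀.category,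
        FrobenioidFacade.AutActionFactorsThrough (C₀.base ⋙ cnst) C₀.toElem A) ∧
      (∀ A : C₀.category, FrobenioidFacade.AutActionFaithful (C₀.base ⋙ cnst) C₀.toElem A)) := by
  have hQΛ : C₀.monoidType = MonoidType.Q := rfl
  obtain ⟨⟨-, -, hi3, hi4, hi5, hi6, hi7⟩, hii, ⟨hiii1, hiii2⟩, -⟩ :=
    thm37_of_inputs_of_cnst.{u₀, v₀, u₁, u₁, u, v, w, 0} C₀ 2 hBmon
      (fun hZ => absurd (hQΛ.symm.trans hZ) (by decide))
      (fun hR => absurd (hQΛ.symm.trans hR) (by decide)) hD hnd hrat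
      (RealifiedDivisorMonoids.Prop34Cnst.ofRlfQWeak h34 h₀ hQ)
      (RealifiedDivisorMonoids.ofRlfQWeak_line dm hpf hcyc)
      (fun Y => IsPerfFactorialWeak.Rlf.isCancelMul (hpf Y).weak) fun Z φ => CosetCat.isOfFinOrder_aut Z φ
  exact ⟨⟨hi3, hi4, hi5, hi6, hi7⟩, hii, ⟨hiii1, hiii2 (Or.inr hQΛ)⟩⟩

/-- **The same, knit onto `DivisorMonoids.Prop34Const`** (`hcyc := Prop34Const.hcyc hC`); residual binders
{`hBmon`, `hD`, `hnd`, `hrat`, `h34`, `h₀`, `hQ`, `hC : dm.Prop34Const`}. [cite: MochizukiEtTh2009, Thm 3.7 p.79] -/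
theorem thm37_ofRlfQWeak_of_inputs_of_prop34Const
    (C₀ : TemperedFrobenioid (RealifiedDivisorMonoids.ofRlfQWeak dm hpf) D
      (treeCatVocab D IsRational IsStrictlyRational))
    (hBmon : IsMonoidOn C₀.ratFnFunctor)
    (hD : IsOfFSMFFType D) (hnd : IsNonDilatingOn C₀.divisorMonoid)
    (hrat : ∀ X : C₀.category,
      PreFrobenioidData.IsRational
        (PreFrobenioid.biratData (C₀.isFrobenioid_treeCatVocab_of_isMonoidOn hBmon)
          (PreFrobenioid.hasBiratSquares_of_isFrobenioid (C₀.isFrobenioid_treeCatVocab_of_isMonoidOn hBmon)))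
        (S := PreFrobenioidData.ofFunctor C₀.divisorMonoid C₀.toElem) (fun a 𝔭 => PrimarySupp a 𝔭) X)
    (h34 : dm.Prop34 V V₀) (h₀ : dm.Prop34Cnst₀ cnst)
    (hQ : ∀ {Y : D₀} (g g' : Y ≅ Y),
      (∀ b : dm.B₀.obj (op Y), dm.div₀ (op Y) b = 1 →
        ∃ N : ℕ+, ((dm.B₀.map g.hom.op).hom b) ^ (N : ℕ) = ((dm.B₀.map g'.hom.op).hom b) ^ (N : ℕ)) →
      cnst.map g.hom = cnst.map g'.hom)
    (hC : dm.Prop34Const) :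
    (PreFrobenioid.IsOfIsotropicType C₀.toElem ∧
      PreFrobenioid.IsOfModelType C₀.toElem (C₀.isFrobenioid_treeCatVocab_of_isMonoidOn hBmon)
        (PreFrobenioid.hasBiratSquares_of_isFrobenioid (C₀.isFrobenioid_treeCatVocab_of_isMonoidOn hBmon)) ∧
      PreFrobenioidData.IsOfBiratFrobeniusNormalizedType
        (PreFrobenioid.biratData (C₀.isFrobenioid_treeCatVocab_of_isMonoidOn hBmon)
          (PreFrobenioid.hasBiratSquares_of_isFrobenioid (C₀.isFrobenioid_treeCatVocab_of_isMonoidOn hBmon))) ∧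
      PreFrobenioid.IsOfType (PreFrobenioid.IsSubQuasiFrobeniusTrivial C₀.toElem) ∧
      ¬ PreFrobenioid.IsOfType (PreFrobenioid.IsGroupLikeObj C₀.toElem)) ∧
    ((ModelFrobenioid.data C₀.divisorMonoid C₀.ratFnFunctor C₀.divBNatTrans).IsOfStandardType ∧
      (PreFrobenioidData.ofFunctor C₀.divisorMonoid C₀.toElem).IsOfRationallyStandardType
        (PreFrobenioid.rsParams (C₀.isFrobenioid_treeCatVocab_of_isMonoidOn hBmon) fun a 𝔭 => PrimarySupp a 𝔭)) ∧
    ((∀ A : C₀.category,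
        FrobenioidFacade.AutActionFactorsThrough (C₀.base ⋙ cnst) C₀.toElem A) ∧
      (∀ A : C₀.category, FrobenioidFacade.AutActionFaithful (C₀.base ⋙ cnst) C₀.toElem A)) :=
  thm37_ofRlfQWeak_of_inputs_of_cosetCnst C₀ hBmon hD hnd hrat h34 h₀ hQ hC.hcyc

/-! ### §2 `Λ = ℝ` weak data, `D^cnst = 𝓑(G)⁰` -/

/-- **[EtTh] Theorem 3.7 (i)–(iv) for a tempered Frobenioid of monoid type `ℝ` over the CONSTRUCTED weak data
`ofRlfRWeak dm hpf`, with `D^cnst = 𝓑(G)⁰` (`G` compact)** — `hKfix` DERIVED (`ofRlfRWeak_line` +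
`IsPerfFactorialWeak.Rlf.isCancelMul` + `CosetCat.isOfFinOrder_aut`): residual binders {`hBmon`, `hD`, `hnd`, `hrat`,
`h₀ : dm.Prop34Cnst₀ cnst`, `hE` (clause 1 of Prop. 3.4 (ii) at `Λ = ℝ` for THE weak realification data, the exact
residual, `Sec3Prop34CnstOfRlfRWeak`), `hcyc`}.  Unit-TRIVIAL type outright (`ofRlfRWeak_divΛ_injective`); (iii) first
clause; (iv). [cite: MochizukiEtTh2009, Thm 3.7 p.79] -/
theorem thm37_ofRlfRWeak_of_inputs_of_cosetCnst
    (C₀ : TemperedFrobenioid (RealifiedDivisorMonoids.ofRlfRWeak dm hpf) D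
      (treeCatVocab D IsRational IsStrictlyRational))
    (hBmon : IsMonoidOn C₀.ratFnFunctor)
    (hD : IsOfFSMFFType D) (hnd : IsNonDilatingOn C₀.divisorMonoid)
    (hrat : ∀ X : C₀.category,
      PreFrobenioidData.IsRational
        (PreFrobenioid.biratData (C₀.isFrobenioid_treeCatVocab_of_isMonoidOn hBmon)
          (PreFrobenioid.hasBiratSquares_of_isFrobenioid (C₀.isFrobenioid_treeCatVocab_of_isMonoidOn hBmon)))
        (S := PreFrobenioidData.ofFunctor C₀.divisorMonoid C₀.toElem) (fun a 𝔭 => PrimarySupp a 𝔭) X)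
    (h₀ : dm.Prop34Cnst₀ cnst)
    (hE : ∀ (Y : D₀)
      (b : Algebra.GrothendieckGroup ((RealifiedDivisorMonoids.realDataWeak dm hpf).rlf.obj (op Y)))
      (x : (hpf (op Y)).weak.Rlf),
      b ∈ ((RealifiedDivisorMonoids.realDataWeak dm hpf).realSpan dm.biratGp).carrier Y →
        b = Algebra.GrothendieckGroup.of x →
        b ∈ ((RealifiedDivisorMonoids.realDataWeak dm hpf).realSpan dm.cnstGp).carrier Y)
    (hcyc : ∀ Y : D₀ᵒᵖ, ∃ d : dm.Φ₀.obj Y, ∀ b ∈ dm.F₀ Y, ∃ n : ℤ,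
      dm.div₀ Y b = Algebra.GrothendieckGroup.of d ^ n)
    :
    (PreFrobenioid.IsOfType (PreFrobenioid.IsUnitTrivial C₀.toElem) ∧
      PreFrobenioid.IsOfIsotropicType C₀.toElem ∧
      PreFrobenioid.IsOfModelType C₀.toElem (C₀.isFrobenioid_treeCatVocab_of_isMonoidOn hBmon)
        (PreFrobenioid.hasBiratSquares_of_isFrobenioid (C₀.isFrobenioid_treeCatVocab_of_isMonoidOn hBmon)) ∧
      PreFrobenioidData.IsOfBiratFrobeniusNormalizedType
        (PreFrobenioid.biratData (C₀.isFrobenioid_treeCatVocab_of_isMonoidOn hBmon)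
          (PreFrobenioid.hasBiratSquares_of_isFrobenioid (C₀.isFrobenioid_treeCatVocab_of_isMonoidOn hBmon))) ∧
      PreFrobenioid.IsOfType (PreFrobenioid.IsSubQuasiFrobeniusTrivial C₀.toElem) ∧
      ¬ PreFrobenioid.IsOfType (PreFrobenioid.IsGroupLikeObj C₀.toElem)) ∧
    ((ModelFrobenioid.data C₀.divisorMonoid C₀.ratFnFunctor C₀.divBNatTrans).IsOfStandardType ∧
      (PreFrobenioidData.ofFunctor C₀.divisorMonoid C₀.toElem).IsOfRationallyStandardType
        (PreFrobenioid.rsParams (C₀.isFrobenioid_treeCatVocab_of_isMonoidOn hBmon) fun a 𝔭 => PrimarySupp a 𝔭)) ∧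
    (∀ A : C₀.category, FrobenioidFacade.AutActionFactorsThrough (C₀.base ⋙ cnst) C₀.toElem A) ∧
    C₀.Thm37_iv := by
  have hR : C₀.monoidType = MonoidType.R := rfl
  obtain ⟨⟨-, hi2, hi3, hi4, hi5, hi6, hi7⟩, hii, ⟨hiii1, -⟩, hiv⟩ :=
    thm37_of_inputs_of_cnst.{u₀, v₀, u₁, u₁, u, v, w, 0} C₀ 2 hBmon
      (fun hZ => absurd (hR.symm.trans hZ) (by decide))
      (fun _ A => RealifiedDivisorMonoids.ofRlfRWeak_divΛ_injective dm hpf (C₀.baseOp A)) hD hnd hrat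
      (RealifiedDivisorMonoids.Prop34Cnst.ofRlfRWeak_of_eff h₀ hE)
      (RealifiedDivisorMonoids.ofRlfRWeak_line dm hpf hcyc)
      (fun Y => IsPerfFactorialWeak.Rlf.isCancelMul (hpf Y).weak) fun Z φ => CosetCat.isOfFinOrder_aut Z φ
  exact ⟨⟨hi2 hR, hi3, hi4, hi5, hi6, hi7⟩, hii, hiii1, hiv⟩

/-- **The same, knit onto `DivisorMonoids.Prop34Const`** (`hcyc := Prop34Const.hcyc hC`): residual binders
{`hBmon`, `hD`, `hnd`, `hrat`, `h₀`, `hE`, `hC : dm.Prop34Const`}. [cite: MochizukiEtTh2009, Thm 3.7 p.79] -/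
theorem thm37_ofRlfRWeak_of_inputs_of_prop34Const
    (C₀ : TemperedFrobenioid (RealifiedDivisorMonoids.ofRlfRWeak dm hpf) D
      (treeCatVocab D IsRational IsStrictlyRational))
    (hBmon : IsMonoidOn C₀.ratFnFunctor)
    (hD : IsOfFSMFFType D) (hnd : IsNonDilatingOn C₀.divisorMonoid)
    (hrat : ∀ X : C₀.category,
      PreFrobenioidData.IsRational
        (PreFrobenioid.biratData (C₀.isFrobenioid_treeCatVocab_of_isMonoidOn hBmon)
          (PreFrobenioid.hasBiratSquares_of_isFrobenioid (C₀.isFrobenioid_treeCatVocab_of_isMonoidOn hBmon)))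
        (S := PreFrobenioidData.ofFunctor C₀.divisorMonoid C₀.toElem) (fun a 𝔭 => PrimarySupp a 𝔭) X)
    (h₀ : dm.Prop34Cnst₀ cnst)
    (hE : ∀ (Y : D₀)
      (b : Algebra.GrothendieckGroup ((RealifiedDivisorMonoids.realDataWeak dm hpf).rlf.obj (op Y)))
      (x : (hpf (op Y)).weak.Rlf),
      b ∈ ((RealifiedDivisorMonoids.realDataWeak dm hpf).realSpan dm.biratGp).carrier Y →
        b = Algebra.GrothendieckGroup.of x →
        b ∈ ((RealifiedDivisorMonoids.realDataWeak dm hpf).realSpan dm.cnstGp).carrier Y)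
    (hC : dm.Prop34Const) :
    (PreFrobenioid.IsOfType (PreFrobenioid.IsUnitTrivial C₀.toElem) ∧
      PreFrobenioid.IsOfIsotropicType C₀.toElem ∧
      PreFrobenioid.IsOfModelType C₀.toElem (C₀.isFrobenioid_treeCatVocab_of_isMonoidOn hBmon)
        (PreFrobenioid.hasBiratSquares_of_isFrobenioid (C₀.isFrobenioid_treeCatVocab_of_isMonoidOn hBmon)) ∧
      PreFrobenioidData.IsOfBiratFrobeniusNormalizedType
        (PreFrobenioid.biratData (C₀.isFrobenioid_treeCatVocab_of_isMonoidOn hBmon)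
          (PreFrobenioid.hasBiratSquares_of_isFrobenioid (C₀.isFrobenioid_treeCatVocab_of_isMonoidOn hBmon))) ∧
      PreFrobenioid.IsOfType (PreFrobenioid.IsSubQuasiFrobeniusTrivial C₀.toElem) ∧
      ¬ PreFrobenioid.IsOfType (PreFrobenioid.IsGroupLikeObj C₀.toElem)) ∧
    ((ModelFrobenioid.data C₀.divisorMonoid C₀.ratFnFunctor C₀.divBNatTrans).IsOfStandardType ∧
      (PreFrobenioidData.ofFunctor C₀.divisorMonoid C₀.toElem).IsOfRationallyStandardType
        (PreFrobenioid.rsParams (C₀.isFrobenioid_treeCatVocab_of_isMonoidOn hBmon) fun a 𝔭 => PrimarySupp a 𝔭)) ∧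
    (∀ A : C₀.category, FrobenioidFacade.AutActionFactorsThrough (C₀.base ⋙ cnst) C₀.toElem A) ∧
    C₀.Thm37_iv :=
  thm37_ofRlfRWeak_of_inputs_of_cosetCnst C₀ hBmon hD hnd hrat h₀ hE hC.hcyc

end TemperedFrobenioid

end Literature.AnabelianGeometry.EtaleTheta
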